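import Summits.CriticalPhenomena.PercolationContinuityZ3.Theorems.PercNearOneGluingNoHeavyLowerTailHeavyOutsiderStep
import HarnessLib

/-!
# `NoHeavyLowerTail` (stmt-CriticalPhenomena-4575) — the CHAMPION-EDGE STEP of the two-sided kernel (DC):
# lowering the champion's own pair keeps it the champion, so the deleted face is free

Support file (prover `prim-hp-3`, hull-port line; `--supports stmt-CriticalPhenomena-4575`).  No definitions, no named facts, no sorries.

Notation as in `…OutsiderPortStep.lean`: `μ_w = prodBernoulli w` on `Fin n`, relays `A`, level `j`, a finite observer set `O`, `I_w(v) = μ_w{|π(v)| ≤ j}`,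
E-mass `E_w(c) = μ_w(c ↮ O, 1 ≤ |π(O)| ≤ j) + μ_w(c ↔ O, |π(c)| ≤ j)`; a pair `e = s(t,o)` at a vertex `t`, `w₀ = w[e↦0]`, `w₁ = w[e↦1]`.

* `HullPort.lightness_ge_of_lower_own_edge` — **lowering a pair at the WINNER of a lightness comparison preserves the comparison**: if `w e < 1`
  and `I_w(x) ≤ I_w(t)` then `I_{w₀}(x) ≤ I_{w₀}(t)`.  (Affinity in the coordinate + the glued comparison `CutObserver.lightness_glued_le`, van den
  Berg–Häggström–Kahn Thm 1.5; the companion of `lightness_le_of_raise_own_edge`, which raises a pair at the LOSER.)  Consequence: the champion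
  port `t` of `w` (no port is `w`-lighter) is still no heavier than any port once its own pair is deleted — in particular than the (DC)-witness of the
  deleted instance.
* `HullPort.obsE_erase_le_champion` — hence, if (DC) holds for `v` in `w₀` with a witness `q` that `t` dominates in `w` (e.g. any port of `w`), then
  `E_{w₀}(v) ≤ I_{w₀}(t)`: at the deleted face the champion itself is a witness, although it need not be a port there.
* `HullPort.obsE_le_champion_of_glued_le` — **the champion-edge step**: if moreover `E_{w₁}(v) ≤ I_{w₁}(t)` at the glued face, then `E_w(v) ≤ I_w(t)`
  (common witness `t`, `obsE_le_of_common_witness`).  With `o ∈ O` the glued-face hypothesis holds for every `v` that is no lighter than `t` in `w₁`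
  (`obsE_glued_le_of_heavier`), so this contains the heavy outsider step along the champion's pair; numerically (crux notes `HULLPORT-REF-gen6.md` §15)
  it covers 97–99 % of outsider pairs in random two-pendant-stars designs and 83 % of ttrl's jointcov-hard pairs — the open residue of the (DC) induction is
  `E_{w₁}(v) > I_{w₁}(t)`, i.e. an outsider whose gluing drop at the glued face exceeds the glued champion's, and there (DC) is EQUIVALENT to
  `w e · (E_{w₁}(v) − I_{w₁}(t)) ≤ (1 − w e) · (I_{w₀}(t) − E_{w₀}(v))` with a right-hand side now proved nonnegative.
-/

noncomputable section

namespace Summit.CriticalPhenomena.PercolationContinuityZ3.Theorems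

open MeasureTheory Set Literature.Probability.LatticeModels Literature.Probability.Percolation
open scoped Classical BigOperators

variable {n : ℕ}

namespace HullPort

/-- **Lowering a pair at the winner preserves a lightness comparison.**  `e = s(t,o)`, `t ≠ o`, `x ≠ t`, `w e < 1`: if `I_w(x) ≤ I_w(t)` then
`I_{w[e↦0]}(x) ≤ I_{w[e↦0]}(t)`.  [cite: VandenbergHaggstromKahn2005, Thm. 1.5 (p. 7) — via `CutObserver.lightness_glued_le`; this work] -/
theorem lightness_ge_of_lower_own_edge (w : Sym2 (Fin n) → unitInterval) (A : Finset (Fin n)) (t o x : Fin n) (j : ℕ)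
    (hto : t ≠ o) (hxt : x ≠ t) (hlt : (w s(t, o) : ℝ) < 1)
    (hle : (prodBernoulli w).real {ω : BondConfig (Fin n) | (A.filter fun z => ω ∈ openConn x z).card ≤ j} ≤
      (prodBernoulli w).real {ω : BondConfig (Fin n) | (A.filter fun z => ω ∈ openConn t z).card ≤ j}) :
    (prodBernoulli (Function.update w s(t, o) 0)).real {ω : BondConfig (Fin n) | (A.filter fun z => ω ∈ openConn x z).card ≤ j} ≤
      (prodBernoulli (Function.update w s(t, o) 0)).real {ω : BondConfig (Fin n) | (A.filter fun z => ω ∈ openConn t z).card ≤ j} := by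
  set e : Sym2 (Fin n) := s(t, o) with he
  set Rt := {ω : BondConfig (Fin n) | (A.filter fun z => ω ∈ openConn t z).card ≤ j} with hRt
  set Rx := {ω : BondConfig (Fin n) | (A.filter fun z => ω ∈ openConn x z).card ≤ j} with hRx
  set w₀ := Function.update w e 0 with hw₀
  by_contra hcon
  push Not at hcon
  -- at weight 0 the vertex `t` loses strictly; gluing its own pair keeps it losing (BHK)
  have hw₀e : w₀ s(t, o) = 0 := by simp [hw₀, he]
  have hw₁ : Function.update w e 1 = Function.update w₀ s(t, o) 1 := by
    rw [hw₀, he, Function.update_idem]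
  have hglue : (prodBernoulli (Function.update w e 1)).real Rt ≤ (prodBernoulli (Function.update w e 1)).real Rx := by
    rw [hw₁]
    exact CutObserver.lightness_glued_le w₀ A t o x j hto hxt hw₀e (le_of_lt hcon)
  -- affinity in the coordinate `e` at the actual weight `w e`
  have hwe : Function.update w e (w e) = w := Function.update_eq_self e w
  have ha_t := real_update_affine w e (w e) Rt
  have ha_x := real_update_affine w e (w e) Rx
  rw [hwe] at ha_t ha_x
  rw [← hw₀] at ha_t ha_x
  have hu0 : 0 ≤ (w e : ℝ) := (w e).2.1
  have h1 : 0 < 1 - (w e : ℝ) := by linarith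
  -- `I_w(t) - I_w(x) = (1 - w e)(I₀(t) - I₀(x)) + (w e)(I₁(t) - I₁(x)) < 0`, contradicting `hle`
  have hneg : (prodBernoulli w).real Rt - (prodBernoulli w).real Rx < 0 := by
    rw [ha_t, ha_x]
    have hA : (1 - (w e : ℝ)) * ((prodBernoulli w₀).real Rt - (prodBernoulli w₀).real Rx) < 0 :=
      mul_neg_of_pos_of_neg h1 (by linarith)
    have hB : (w e : ℝ) * ((prodBernoulli (Function.update w e 1)).real Rt -
        (prodBernoulli (Function.update w e 1)).real Rx) ≤ 0 :=
      mul_nonpos_of_nonneg_of_nonpos hu0 (by linarith)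
    nlinarith
  have : (prodBernoulli w).real Rx ≤ (prodBernoulli w).real Rt := hle
  linarith

/-- **At the deleted face the champion is a witness.**  `e = s(t,o)`, `w e < 1`, and `t` dominates `q` in `w` (`I_w(q) ≤ I_w(t)`, e.g. `t` the champion port and
`q` any port).  If `E_{w[e↦0]}(v) ≤ I_{w[e↦0]}(q)` ((DC) for `v` one pair down, witness `q`), then `E_{w[e↦0]}(v) ≤ I_{w[e↦0]}(t)`.
[cite: VandenbergHaggstromKahn2005, Thm. 1.5 (p. 7) — via `lightness_ge_of_lower_own_edge`; this work] -/
theorem obsE_erase_le_champion (w : Sym2 (Fin n) → unitInterval) (A O : Finset (Fin n)) (t o v q : Fin n) (j : ℕ)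
    (hto : t ≠ o) (hlt : (w s(t, o) : ℝ) < 1)
    (hdom : (prodBernoulli w).real {ω : BondConfig (Fin n) | (A.filter fun z => ω ∈ openConn q z).card ≤ j} ≤
      (prodBernoulli w).real {ω : BondConfig (Fin n) | (A.filter fun z => ω ∈ openConn t z).card ≤ j})
    (h0 : (prodBernoulli (Function.update w s(t, o) 0)).real {ω : BondConfig (Fin n) | (∀ x ∈ O, ω ∉ openConn v x) ∧
          1 ≤ (A.filter fun z => ∃ x ∈ O, ω ∈ openConn x z).card ∧
          (A.filter fun z => ∃ x ∈ O, ω ∈ openConn x z).card ≤ j} +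
        (prodBernoulli (Function.update w s(t, o) 0)).real {ω : BondConfig (Fin n) | (∃ x ∈ O, ω ∈ openConn v x) ∧
          (A.filter fun z => ω ∈ openConn v z).card ≤ j} ≤
        (prodBernoulli (Function.update w s(t, o) 0)).real
          {ω : BondConfig (Fin n) | (A.filter fun z => ω ∈ openConn q z).card ≤ j}) :
    (prodBernoulli (Function.update w s(t, o) 0)).real {ω : BondConfig (Fin n) | (∀ x ∈ O, ω ∉ openConn v x) ∧
          1 ≤ (A.filter fun z => ∃ x ∈ O, ω ∈ openConn x z).card ∧
          (A.filter fun z => ∃ x ∈ O, ω ∈ openConn x z).card ≤ j} +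
        (prodBernoulli (Function.update w s(t, o) 0)).real {ω : BondConfig (Fin n) | (∃ x ∈ O, ω ∈ openConn v x) ∧
          (A.filter fun z => ω ∈ openConn v z).card ≤ j} ≤
      (prodBernoulli (Function.update w s(t, o) 0)).real {ω : BondConfig (Fin n) | (A.filter fun z => ω ∈ openConn t z).card ≤ j} := by
  by_cases hqt : q = t
  · subst hqt; exact h0
  · exact h0.trans (lightness_ge_of_lower_own_edge w A t o q j hto hqt hlt hdom)

/-- **The champion-edge step.**  `e = s(t,o)`, `w e < 1`, `I_w(q) ≤ I_w(t)`.  If `E_{w[e↦0]}(v) ≤ I_{w[e↦0]}(q)` ((DC) one pair down) and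
`E_{w[e↦1]}(v) ≤ I_{w[e↦1]}(t)` (the glued champion dominates `v`'s E-mass at the glued face — automatic when `o ∈ O` and `v` is no lighter than `t`
there, `obsE_glued_le_of_heavier`), then `E_w(v) ≤ I_w(t)`.  [cite: VandenbergHaggstromKahn2005, Thm. 1.5 (p. 7) — via `obsE_erase_le_champion` and
`obsE_le_of_common_witness`; this work] -/
theorem obsE_le_champion_of_glued_le (w : Sym2 (Fin n) → unitInterval) (A O : Finset (Fin n)) (t o v q : Fin n) (j : ℕ)
    (hto : t ≠ o) (hlt : (w s(t, o) : ℝ) < 1)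
    (hdom : (prodBernoulli w).real {ω : BondConfig (Fin n) | (A.filter fun z => ω ∈ openConn q z).card ≤ j} ≤
      (prodBernoulli w).real {ω : BondConfig (Fin n) | (A.filter fun z => ω ∈ openConn t z).card ≤ j})
    (h0 : (prodBernoulli (Function.update w s(t, o) 0)).real {ω : BondConfig (Fin n) | (∀ x ∈ O, ω ∉ openConn v x) ∧
          1 ≤ (A.filter fun z => ∃ x ∈ O, ω ∈ openConn x z).card ∧
          (A.filter fun z => ∃ x ∈ O, ω ∈ openConn x z).card ≤ j} +
        (prodBernoulli (Function.update w s(t, o) 0)).real {ω : BondConfig (Fin n) | (∃ x ∈ O, ω ∈ openConn v x) ∧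
          (A.filter fun z => ω ∈ openConn v z).card ≤ j} ≤
        (prodBernoulli (Function.update w s(t, o) 0)).real
          {ω : BondConfig (Fin n) | (A.filter fun z => ω ∈ openConn q z).card ≤ j})
    (h1 : (prodBernoulli (Function.update w s(t, o) 1)).real {ω : BondConfig (Fin n) | (∀ x ∈ O, ω ∉ openConn v x) ∧
          1 ≤ (A.filter fun z => ∃ x ∈ O, ω ∈ openConn x z).card ∧
          (A.filter fun z => ∃ x ∈ O, ω ∈ openConn x z).card ≤ j} +
        (prodBernoulli (Function.update w s(t, o) 1)).real {ω : BondConfig (Fin n) | (∃ x ∈ O, ω ∈ openConn v x) ∧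
          (A.filter fun z => ω ∈ openConn v z).card ≤ j} ≤
        (prodBernoulli (Function.update w s(t, o) 1)).real
          {ω : BondConfig (Fin n) | (A.filter fun z => ω ∈ openConn t z).card ≤ j}) :
    (prodBernoulli w).real {ω : BondConfig (Fin n) | (∀ x ∈ O, ω ∉ openConn v x) ∧
        1 ≤ (A.filter fun z => ∃ x ∈ O, ω ∈ openConn x z).card ∧
        (A.filter fun z => ∃ x ∈ O, ω ∈ openConn x z).card ≤ j} +
      (prodBernoulli w).real {ω : BondConfig (Fin n) | (∃ x ∈ O, ω ∈ openConn v x) ∧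
        (A.filter fun z => ω ∈ openConn v z).card ≤ j} ≤
      (prodBernoulli w).real {ω : BondConfig (Fin n) | (A.filter fun z => ω ∈ openConn t z).card ≤ j} :=
  obsE_le_of_common_witness w A O s(t, o) v t j (obsE_erase_le_champion w A O t o v q j hto hlt hdom h0) h1

/-- **The champion-edge step, heavy form** (`o ∈ O`): if `v` is no lighter than `t` at the glued face, `I_{w[e↦1]}(v) ≤ I_{w[e↦1]}(t)`, the glued-face
hypothesis of `obsE_le_champion_of_glued_le` holds by `obsE_glued_le_of_heavier`, so `E_w(v) ≤ I_w(t)`.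
[cite: VandenbergHaggstromKahn2005, Thm. 1.5 (p. 7) — via `obsE_glued_le_of_heavier`; this work] -/
theorem obsE_le_champion_of_glued_heavier (w : Sym2 (Fin n) → unitInterval) (A O : Finset (Fin n)) (t o v q : Fin n) (j : ℕ)
    (ho : o ∈ O) (hto : t ≠ o) (hlt : (w s(t, o) : ℝ) < 1)
    (hdom : (prodBernoulli w).real {ω : BondConfig (Fin n) | (A.filter fun z => ω ∈ openConn q z).card ≤ j} ≤
      (prodBernoulli w).real {ω : BondConfig (Fin n) | (A.filter fun z => ω ∈ openConn t z).card ≤ j})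
    (h0 : (prodBernoulli (Function.update w s(t, o) 0)).real {ω : BondConfig (Fin n) | (∀ x ∈ O, ω ∉ openConn v x) ∧
          1 ≤ (A.filter fun z => ∃ x ∈ O, ω ∈ openConn x z).card ∧
          (A.filter fun z => ∃ x ∈ O, ω ∈ openConn x z).card ≤ j} +
        (prodBernoulli (Function.update w s(t, o) 0)).real {ω : BondConfig (Fin n) | (∃ x ∈ O, ω ∈ openConn v x) ∧
          (A.filter fun z => ω ∈ openConn v z).card ≤ j} ≤
        (prodBernoulli (Function.update w s(t, o) 0)).real
          {ω : BondConfig (Fin n) | (A.filter fun z => ω ∈ openConn q z).card ≤ j})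
    (hheavy : (prodBernoulli (Function.update w s(t, o) 1)).real {ω : BondConfig (Fin n) | (A.filter fun z => ω ∈ openConn v z).card ≤ j} ≤
      (prodBernoulli (Function.update w s(t, o) 1)).real {ω : BondConfig (Fin n) | (A.filter fun z => ω ∈ openConn t z).card ≤ j}) :
    (prodBernoulli w).real {ω : BondConfig (Fin n) | (∀ x ∈ O, ω ∉ openConn v x) ∧
        1 ≤ (A.filter fun z => ∃ x ∈ O, ω ∈ openConn x z).card ∧
        (A.filter fun z => ∃ x ∈ O, ω ∈ openConn x z).card ≤ j} +
      (prodBernoulli w).real {ω : BondConfig (Fin n) | (∃ x ∈ O, ω ∈ openConn v x) ∧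
        (A.filter fun z => ω ∈ openConn v z).card ≤ j} ≤
      (prodBernoulli w).real {ω : BondConfig (Fin n) | (A.filter fun z => ω ∈ openConn t z).card ≤ j} := by
  refine obsE_le_champion_of_glued_le w A O t o v q j hto hlt hdom h0 ?_
  have h := obsE_glued_le_of_heavier (Function.update w s(t, o) 1) A O o t v j ho hto (by simp) hheavy
  exact h

end HullPort

end Summit.CriticalPhenomena.PercolationContinuityZ3.Theorems

end
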